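import Mathlib

/-!
# Three cross-intersecting families: a rank inequality for the down-closed count (`MS3-down`)

Helper file for crux `stmt-CriticalPhenomena-4575` (`NoHeavyLowerTail`, route `PercNearOneGluingNoHeavy`),
new-inequality factory seat `prim-ineq-gen-3` (gen 9).  Everything in this file is PROVED.

Let `P, Q, R` be finite families of finite sets which are pairwise *cross-intersecting*
(`X ∩ Y ≠ ∅` for members of different families), and let `G` be a down-closed family of sets containing
every within-family difference `X \ X'` and every cross meet `X ∩ Y`.  In `ℚ^G` consider the *plain vectors*
`χ_X = ([E ⊆ X])_{E ∈ G}` and the spans `V_P, V_Q, V_R` of the plain vectors of the three families.  Then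

  `#P + #Q + #R ≤ #G + finrank (V_P ⊓ V_Q ⊓ V_R)`                                    (Theorem A′, gen 9)

Proof.  On `ℚ^G` the symmetric form `B(u,w) = Σ_E (-1)^{#E} u(E) w(E)` is nondegenerate, and
`B(χ_X, χ_Y) = Σ_{E ⊆ X ∩ Y} (-1)^{#E} = [X ∩ Y = ∅] = 0` for cross pairs (all subsets of the cross meet lie in
`G`), so `V_P, V_Q, V_R` are pairwise `B`-orthogonal; testing against `E ↦ (-1)^{#E}[E ∩ X' = ∅]` gives
`Σ_{E ⊆ X \ X'} (-1)^{#E} = [X ⊆ X']`, whence the plain vectors of one family are linearly independent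
(`finrank V_P = #P`).  With `U = V_P ⊔ V_Q ⊔ V_R` both `V_P ⊓ V_Q` and `(V_P ⊔ V_Q) ⊓ V_R` are `B`-orthogonal to
`U`, so the modular law gives `#P + #Q + #R = finrank U + finrank (V_P ⊓ V_Q) + finrank ((V_P ⊔ V_Q) ⊓ V_R)
≤ finrank U + finrank U^⊥ + finrank (V_P ⊓ V_Q ⊓ V_R) = #G + finrank (V_P ⊓ V_Q ⊓ V_R)`.

Consequence.  The open inequality `MS3-down` (`#P + #Q + #R ≤ #G` for `G` = subsets of within-family
differences, cross meets and double differences, hypothesis `hMS3down` of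
`OrientedAntipodalHall.card_le_card_goods_above_cyclic_of_down`) follows from the purely linear statement
`V_P ⊓ V_Q ⊓ V_R = ⊥` ("TRIPLE"), which holds in every instance tested (memo MS3-STATE.md §8).
(prim-ineq-gen-3 gen 9, 2026-08-20.)
-/

namespace Summit.CriticalPhenomena.PercolationContinuityZ3.Theorems

namespace ThreeFamilyRank

open Finset Module

variable {α : Type*} [DecidableEq α]

/-- The coordinate space `ℚ^G`. -/
abbrev Vec (G : Finset (Finset α)) : Type _ := ↥G → ℚ

/-- The plain vector of a set `X`: `E ↦ [E ⊆ X]`. -/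
def chi (G : Finset (Finset α)) (X : Finset α) : Vec G :=
  fun E => if (E : Finset α) ⊆ X then 1 else 0

/-- The span of the plain vectors of a family. -/
def V (G : Finset (Finset α)) (P : Finset (Finset α)) : Submodule ℚ (Vec G) :=
  Submodule.span ℚ (Set.range fun X : ↥P => chi G (X : Finset α))

/-- The signed coordinate form `B(u,w) = Σ_E (-1)^{#E} u(E) w(E)`. -/
def sform (G : Finset (Finset α)) : LinearMap.BilinForm ℚ (Vec G) :=
  LinearMap.mk₂ ℚ (fun u w => ∑ E : ↥G, (-1 : ℚ) ^ #(E : Finset α) * u E * w E)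
    (fun u₁ u₂ w => by
      simp only [Pi.add_apply]
      rw [← Finset.sum_add_distrib]
      exact Finset.sum_congr rfl fun E _ => by ring)
    (fun c u w => by
      simp only [Pi.smul_apply, smul_eq_mul]
      rw [Finset.mul_sum]
      exact Finset.sum_congr rfl fun E _ => by ring)
    (fun u w₁ w₂ => by
      simp only [Pi.add_apply]
      rw [← Finset.sum_add_distrib]
      exact Finset.sum_congr rfl fun E _ => by ring)
    (fun c u w => by
      simp only [Pi.smul_apply, smul_eq_mul]
      rw [Finset.mul_sum]
      exact Finset.sum_congr rfl fun E _ => by ring)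

omit [DecidableEq α] in
/-- Unfolding the signed coordinate form. -/
theorem sform_apply (G : Finset (Finset α)) (u w : Vec G) :
    sform G u w = ∑ E : ↥G, (-1 : ℚ) ^ #(E : Finset α) * u E * w E := rfl

omit [DecidableEq α] in
/-- The signed coordinate form is symmetric. -/
theorem sform_comm (G : Finset (Finset α)) (u w : Vec G) : sform G u w = sform G w u := by
  rw [sform_apply, sform_apply]
  exact Finset.sum_congr rfl fun E _ => by ring

omit [DecidableEq α] in
/-- The signed coordinate form is reflexive. -/
theorem sform_isRefl (G : Finset (Finset α)) : (sform G).IsRefl := by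
  intro u w h
  rw [sform_comm]; exact h

/-- Pairing with a coordinate vector. -/
theorem sform_single (G : Finset (Finset α)) (u : Vec G) (E₀ : ↥G) :
    sform G u (Pi.single E₀ 1) = (-1 : ℚ) ^ #(E₀ : Finset α) * u E₀ := by
  rw [sform_apply, Finset.sum_eq_single E₀]
  · simp
  · intro E _ hE
    simp [Pi.single_eq_of_ne hE]
  · intro h; exact absurd (Finset.mem_univ E₀) h

/-- The signed coordinate form is nondegenerate (it is diagonal with entries `±1`). -/
theorem sform_nondegenerate (G : Finset (Finset α)) : (sform G).Nondegenerate := by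
  have key : ∀ u : Vec G, (∀ w, sform G u w = 0) → u = 0 := by
    intro u hu
    funext E₀
    have h := hu (Pi.single E₀ 1)
    rw [sform_single] at h
    have hne : (-1 : ℚ) ^ #(E₀ : Finset α) ≠ 0 := pow_ne_zero _ (by norm_num)
    simpa [hne] using h
  refine ⟨fun u hu => key u hu, fun w hw => key w fun u => ?_⟩
  rw [sform_comm]; exact hw u

/-- The basic identity: for `S ∈ G` with `G` down-closed, `Σ_{E ∈ G, E ⊆ S} (-1)^{#E} = [S = ∅]`. -/
theorem sum_sign_subset (G : Finset (Finset α)) (hG : ∀ E ∈ G, ∀ F, F ⊆ E → F ∈ G)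
    {S : Finset α} (hS : S ∈ G) :
    (∑ E : ↥G, (-1 : ℚ) ^ #(E : Finset α) * (if (E : Finset α) ⊆ S then 1 else 0)) =
      if S = ∅ then 1 else 0 := by
  rw [Finset.sum_coe_sort G (fun E : Finset α => (-1 : ℚ) ^ #E * (if E ⊆ S then 1 else 0))]
  rw [show (∑ E ∈ G, (-1 : ℚ) ^ #E * (if E ⊆ S then 1 else 0)) =
      ∑ E ∈ G.filter (· ⊆ S), (-1 : ℚ) ^ #E by
    rw [Finset.sum_filter]
    exact Finset.sum_congr rfl fun E _ => by split_ifs <;> simp]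
  have hfil : G.filter (· ⊆ S) = S.powerset := by
    ext E
    simp only [Finset.mem_filter, Finset.mem_powerset]
    exact ⟨fun h => h.2, fun h => ⟨hG S hS E h, h⟩⟩
  rw [hfil]
  have hz := (sum_powerset_neg_one_pow_card (x := S))
  have hcast : (∑ E ∈ S.powerset, (-1 : ℚ) ^ #E) = ((∑ E ∈ S.powerset, (-1 : ℤ) ^ #E : ℤ) : ℚ) := by
    push_cast; rfl
  rw [hcast, hz]
  split_ifs <;> simp

/-- Cross pairs are `B`-orthogonal: `B(χ_X, χ_Y) = 0` if `X ∩ Y ∈ G` is nonempty. -/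
theorem sform_chi_chi (G : Finset (Finset α)) (hG : ∀ E ∈ G, ∀ F, F ⊆ E → F ∈ G)
    {X Y : Finset α} (hXY : X ∩ Y ∈ G) (hne : (X ∩ Y).Nonempty) :
    sform G (chi G X) (chi G Y) = 0 := by
  rw [sform_apply]
  have h := sum_sign_subset G hG hXY
  rw [if_neg (Finset.nonempty_iff_ne_empty.mp hne)] at h
  rw [← h]
  refine Finset.sum_congr rfl fun E _ => ?_
  simp only [chi]
  by_cases h1 : (E : Finset α) ⊆ X <;> by_cases h2 : (E : Finset α) ⊆ Y <;>
    simp [h1, h2, Finset.subset_inter_iff]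

/-- The coplain test vector of a set `A`: `E ↦ [E ∩ A = ∅]`. -/
def cochi (G : Finset (Finset α)) (A : Finset α) : Vec G :=
  fun E => if Disjoint (E : Finset α) A then 1 else 0

/-- Testing a plain vector against a coplain vector: `B(χ_X, cochi X') = [X ⊆ X']` if `X \ X' ∈ G`. -/
theorem sform_chi_cochi (G : Finset (Finset α)) (hG : ∀ E ∈ G, ∀ F, F ⊆ E → F ∈ G)
    {X X' : Finset α} (hXX' : X \ X' ∈ G) :
    sform G (chi G X) (cochi G X') = if X ⊆ X' then 1 else 0 := by
  rw [sform_apply]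
  have h := sum_sign_subset G hG hXX'
  rw [show (if X ⊆ X' then (1 : ℚ) else 0) = if X \ X' = ∅ then 1 else 0 by
    simp only [Finset.sdiff_eq_empty_iff_subset]]
  rw [← h]
  refine Finset.sum_congr rfl fun E _ => ?_
  simp only [chi, cochi]
  by_cases h1 : (E : Finset α) ⊆ X <;> by_cases h2 : Disjoint (E : Finset α) X' <;>
    simp [h1, h2, Finset.subset_sdiff]

/-- The plain vectors of one family are linearly independent when all its differences lie in `G`. -/
theorem linearIndependent_chi (G : Finset (Finset α)) (hG : ∀ E ∈ G, ∀ F, F ⊆ E → F ∈ G)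
    (P : Finset (Finset α)) (hPP : ∀ X ∈ P, ∀ X' ∈ P, X \ X' ∈ G) :
    LinearIndependent ℚ (fun X : ↥P => chi G (X : Finset α)) := by
  rw [linearIndependent_iff']
  intro s g hsum
  by_contra hcon
  have hfne : (s.filter fun i => g i ≠ 0).Nonempty := by
    by_contra h'
    rw [Finset.not_nonempty_iff_eq_empty, Finset.filter_eq_empty_iff] at h'
    exact hcon fun i hi => by simpa using h' hi
  -- a member with nonzero coefficient of minimal cardinality
  obtain ⟨X₀, hX₀, hmin⟩ := Finset.exists_min_image (s.filter fun i => g i ≠ 0)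
    (fun i : ↥P => #(i : Finset α)) hfne
  rw [Finset.mem_filter] at hX₀
  -- test the relation against `cochi X₀`
  have h0 : sform G (∑ i ∈ s, g i • chi G (i : Finset α)) (cochi G X₀) = 0 := by
    rw [hsum, LinearMap.map_zero, LinearMap.zero_apply]
  rw [map_sum, LinearMap.sum_apply] at h0
  simp only [LinearMap.map_smul, LinearMap.smul_apply, smul_eq_mul] at h0
  have h1 : ∀ i ∈ s, g i * sform G (chi G (i : Finset α)) (cochi G X₀) =
      if i = X₀ then g X₀ else 0 := by
    intro i hi
    rw [sform_chi_cochi G hG (hPP _ i.2 _ X₀.2)]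
    by_cases hiX : i = X₀
    · subst hiX; simp
    · rw [if_neg hiX]
      by_cases hsub : (i : Finset α) ⊆ X₀
      · -- strict subset: smaller cardinality, so `g i = 0`
        have hne : (i : Finset α) ≠ X₀ := fun h => hiX (Subtype.ext h)
        have hlt : #(i : Finset α) < #(X₀ : Finset α) :=
          Finset.card_lt_card (lt_of_le_of_ne hsub hne)
        have hgi : g i = 0 := by
          by_contra hgi
          exact absurd (hmin i (Finset.mem_filter.mpr ⟨hi, hgi⟩)) (not_le.mpr hlt)
        simp [hgi]
      · simp [hsub]
  rw [Finset.sum_congr rfl h1, Finset.sum_ite_eq' s X₀, if_pos hX₀.1] at h0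
  exact hX₀.2 h0

/-- Hence the span of the plain vectors of a family with all differences in `G` has dimension `#P`. -/
theorem finrank_V (G : Finset (Finset α)) (hG : ∀ E ∈ G, ∀ F, F ⊆ E → F ∈ G)
    (P : Finset (Finset α)) (hPP : ∀ X ∈ P, ∀ X' ∈ P, X \ X' ∈ G) :
    finrank ℚ (V G P) = #P := by
  rw [V, finrank_span_eq_card (linearIndependent_chi G hG P hPP)]
  simp

/-- Cross-orthogonality lifted to spans: if every cross meet `X ∩ Y` (`Y ∈ Q`) lies in `G` and is nonempty,
the functional `B(χ_X, ·)` vanishes on `V G Q`. -/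
theorem V_le_ker_sform_chi (G : Finset (Finset α)) (hG : ∀ E ∈ G, ∀ F, F ⊆ E → F ∈ G)
    {X : Finset α} {Q : Finset (Finset α)} (hXQ : ∀ Y ∈ Q, X ∩ Y ∈ G ∧ (X ∩ Y).Nonempty) :
    V G Q ≤ LinearMap.ker (sform G (chi G X)) := by
  rw [V, Submodule.span_le]
  rintro _ ⟨Y, rfl⟩
  simp only [SetLike.mem_coe, LinearMap.mem_ker]
  obtain ⟨h1, h2⟩ := hXQ Y Y.2
  exact sform_chi_chi G hG h1 h2

/-- A vector `w` which is `B`-orthogonal to all plain vectors of `P`, `Q`, `R` lies in the `B`-orthogonal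
complement of `V G P ⊔ V G Q ⊔ V G R`. -/
theorem mem_orthogonal_of_forall (G : Finset (Finset α)) {P Q R : Finset (Finset α)} {w : Vec G}
    (hP : ∀ X ∈ P, sform G (chi G X) w = 0) (hQ : ∀ Y ∈ Q, sform G (chi G Y) w = 0)
    (hR : ∀ Z ∈ R, sform G (chi G Z) w = 0) :
    w ∈ (sform G).orthogonal (V G P ⊔ V G Q ⊔ V G R) := by
  rw [LinearMap.BilinForm.mem_orthogonal_iff]
  intro n hn
  have hle : V G P ⊔ V G Q ⊔ V G R ≤ LinearMap.ker ((sform G).flip w) := by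
    have aux : ∀ S : Finset (Finset α), (∀ X ∈ S, sform G (chi G X) w = 0) →
        V G S ≤ LinearMap.ker ((sform G).flip w) := by
      intro S hS
      rw [V, Submodule.span_le]
      rintro _ ⟨X, rfl⟩
      simp only [SetLike.mem_coe, LinearMap.mem_ker]
      exact hS X X.2
    exact sup_le (sup_le (aux P hP) (aux Q hQ)) (aux R hR)
  exact LinearMap.mem_ker.mp (hle hn)

omit [DecidableEq α] in
/-- `dim ℚ^G = #G`. -/
theorem finrank_Vec (G : Finset (Finset α)) : finrank ℚ (Vec G) = #G := by
  rw [Module.finrank_fintype_fun_eq_card, Fintype.card_coe]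

/-- **Theorem A′ (gen 9).**  For three pairwise cross-intersecting families `P, Q, R` and a down-closed family
`G` containing all within-family differences and all cross meets,
`#P + #Q + #R ≤ #G + finrank (V_P ⊓ V_Q ⊓ V_R)`, where `V_T ⊆ ℚ^G` is the span of the plain vectors
`([E ⊆ X])_{E ∈ G}`, `X ∈ T`. -/
theorem card_add_card_add_card_le (G : Finset (Finset α)) (hG : ∀ E ∈ G, ∀ F, F ⊆ E → F ∈ G)
    (P Q R : Finset (Finset α))
    (hPP : ∀ X ∈ P, ∀ X' ∈ P, X \ X' ∈ G) (hQQ : ∀ Y ∈ Q, ∀ Y' ∈ Q, Y \ Y' ∈ G)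
    (hRR : ∀ Z ∈ R, ∀ Z' ∈ R, Z \ Z' ∈ G)
    (hPQ : ∀ X ∈ P, ∀ Y ∈ Q, X ∩ Y ∈ G ∧ (X ∩ Y).Nonempty)
    (hQR : ∀ Y ∈ Q, ∀ Z ∈ R, Y ∩ Z ∈ G ∧ (Y ∩ Z).Nonempty)
    (hRP : ∀ Z ∈ R, ∀ X ∈ P, Z ∩ X ∈ G ∧ (Z ∩ X).Nonempty) :
    #P + #Q + #R ≤ #G + finrank ℚ ↥(V G P ⊓ V G Q ⊓ V G R) := by
  -- reversed cross hypotheses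
  have hQP : ∀ Y ∈ Q, ∀ X ∈ P, Y ∩ X ∈ G ∧ (Y ∩ X).Nonempty := fun Y hY X hX => by
    rw [Finset.inter_comm]; exact hPQ X hX Y hY
  have hRQ : ∀ Z ∈ R, ∀ Y ∈ Q, Z ∩ Y ∈ G ∧ (Z ∩ Y).Nonempty := fun Z hZ Y hY => by
    rw [Finset.inter_comm]; exact hQR Y hY Z hZ
  have hPR : ∀ X ∈ P, ∀ Z ∈ R, X ∩ Z ∈ G ∧ (X ∩ Z).Nonempty := fun X hX Z hZ => by
    rw [Finset.inter_comm]; exact hRP Z hZ X hX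
  -- dimensions of the three spans
  have hP := finrank_V G hG P hPP
  have hQ := finrank_V G hG Q hQQ
  have hR := finrank_V G hG R hRR
  -- the two "defect" subspaces are `B`-orthogonal to `U = V_P ⊔ V_Q ⊔ V_R`
  have hA : V G P ⊓ V G Q ≤ (sform G).orthogonal (V G P ⊔ V G Q ⊔ V G R) := by
    intro w hw
    rw [Submodule.mem_inf] at hw
    refine mem_orthogonal_of_forall G (fun X hX => ?_) (fun Y hY => ?_) (fun Z hZ => ?_)
    · exact V_le_ker_sform_chi G hG (hPQ X hX) hw.2
    · exact V_le_ker_sform_chi G hG (hQP Y hY) hw.1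
    · exact V_le_ker_sform_chi G hG (hRP Z hZ) hw.1
  have hB : (V G P ⊔ V G Q) ⊓ V G R ≤ (sform G).orthogonal (V G P ⊔ V G Q ⊔ V G R) := by
    intro w hw
    rw [Submodule.mem_inf] at hw
    refine mem_orthogonal_of_forall G (fun X hX => ?_) (fun Y hY => ?_) (fun Z hZ => ?_)
    · exact V_le_ker_sform_chi G hG (hPR X hX) hw.2
    · exact V_le_ker_sform_chi G hG (hQR Y hY) hw.2
    · have hle : V G P ⊔ V G Q ≤ LinearMap.ker (sform G (chi G Z)) :=
        sup_le (V_le_ker_sform_chi G hG (hRP Z hZ)) (V_le_ker_sform_chi G hG (hRQ Z hZ))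
      exact hle hw.1
  -- modular law, three times
  have h1 := Submodule.finrank_sup_add_finrank_inf_eq (V G P) (V G Q)
  have h2 := Submodule.finrank_sup_add_finrank_inf_eq (V G P ⊔ V G Q) (V G R)
  have h3 := Submodule.finrank_sup_add_finrank_inf_eq (V G P ⊓ V G Q) ((V G P ⊔ V G Q) ⊓ V G R)
  have h4 : finrank ℚ ↥((V G P ⊓ V G Q) ⊔ ((V G P ⊔ V G Q) ⊓ V G R)) ≤
      finrank ℚ ↥((sform G).orthogonal (V G P ⊔ V G Q ⊔ V G R)) :=
    Submodule.finrank_mono (sup_le hA hB)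
  have h5 : finrank ℚ ↥((V G P ⊓ V G Q) ⊓ ((V G P ⊔ V G Q) ⊓ V G R)) ≤
      finrank ℚ ↥(V G P ⊓ V G Q ⊓ V G R) := by
    apply Submodule.finrank_mono
    intro w hw
    simp only [Submodule.mem_inf] at hw ⊢
    exact ⟨⟨hw.1.1, hw.1.2⟩, hw.2.2⟩
  have h6 := LinearMap.BilinForm.finrank_orthogonal (sform_nondegenerate G) (V G P ⊔ V G Q ⊔ V G R)
  have h7 := finrank_Vec G
  have h8 : finrank ℚ ↥(V G P ⊔ V G Q ⊔ V G R) ≤ finrank ℚ (Vec G) := Submodule.finrank_le _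
  omega

/-- Corollary (the conditional `MS3-down`): if moreover `V_P ⊓ V_Q ⊓ V_R = ⊥` ("TRIPLE"), then
`#P + #Q + #R ≤ #G`. -/
theorem card_add_card_add_card_le_of_triple (G : Finset (Finset α)) (hG : ∀ E ∈ G, ∀ F, F ⊆ E → F ∈ G)
    (P Q R : Finset (Finset α))
    (hPP : ∀ X ∈ P, ∀ X' ∈ P, X \ X' ∈ G) (hQQ : ∀ Y ∈ Q, ∀ Y' ∈ Q, Y \ Y' ∈ G)
    (hRR : ∀ Z ∈ R, ∀ Z' ∈ R, Z \ Z' ∈ G)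
    (hPQ : ∀ X ∈ P, ∀ Y ∈ Q, X ∩ Y ∈ G ∧ (X ∩ Y).Nonempty)
    (hQR : ∀ Y ∈ Q, ∀ Z ∈ R, Y ∩ Z ∈ G ∧ (Y ∩ Z).Nonempty)
    (hRP : ∀ Z ∈ R, ∀ X ∈ P, Z ∩ X ∈ G ∧ (Z ∩ X).Nonempty)
    (hTriple : V G P ⊓ V G Q ⊓ V G R = ⊥) :
    #P + #Q + #R ≤ #G := by
  have h := card_add_card_add_card_le G hG P Q R hPP hQQ hRR hPQ hQR hRP
  rw [hTriple, finrank_bot] at h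
  simpa using h

end ThreeFamilyRank

end Summit.CriticalPhenomena.PercolationContinuityZ3.Theorems
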